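import Summits.NavierStokesRegularity.NavierStokesRegularity.Theses.RellichScar
import Summits.NavierStokesRegularity.NavierStokesRegularity.Theses.RecurrentProfiles
import Summits.NavierStokesRegularity.NavierStokesRegularity.Theses.DulacContraction
import Summits.NavierStokesRegularity.NavierStokesRegularity.Theorems.TypeICertificateLadderNoTypeIBlowupTypeIMorrey
import Summits.NavierStokesRegularity.NavierStokesRegularity.Theorems.RellichScarTypeIBlowupProfileZoomLimit
import Literature.Analysis.FluidPDE.Seregin2020AncientLimit
import Literature.Analysis.FluidPDE.LocalTypeICongr
import Literature.Analysis.FluidPDE.NSCriticalClosureBesovKatoClass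
import Literature.Analysis.FluidPDE.SuitableWeakRescaling
import Literature.Analysis.FluidPDE.SereginSverakPressureDecayBalls

/-!
# Route RellichScar — item `TypeIBlowupProfile` (stmt-NavierStokesRegularity-1591), PROVED

`typeIBlowupProfile_proof : TypeIBlowupProfile` — Type-I-rate blow-up of a maximal classical
Leray–Hopf solution from a rapidly decaying datum generates a suitable weak solution of the
unit-viscosity Navier–Stokes system on the backward slab `ℝ³ × ℝ₋` with a weak spatial gradient,
finite Albritton–Barker quantity `𝐈(ℝ³ × ℝ₋)`, the pointwise Type-I rate `‖w(t, x)‖ ≤ C'/√(−t)`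
and a backward-singular origin (the item shared by the routes RellichScar, RecurrentProfiles and
DulacContraction; the corollaries `typeIBlowupProfile_recurrentProfiles`,
`typeIBlowupProfile_dulacContraction` restate it for the other two route files).  Glue of tree theorems:

1. `morrey_of_typeI` (the Morrey-type bound of a Type-I solution, Seregin–Šverák 2009 Lemma 3.5 /
   Barker–Prange 2020), `exists_singularPoint_of_classical_of_not_hasSmoothExtensionPast`
   (Lemarié-Rieusset 2016, Thm. 15.1 (C): a maximal classical solution has a singular point at
   the maximal time) and `exists_zoom_typeIBound_lt_top_of_morrey` (the viscosity-normalising zoom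
   about `(T, x₀)` is a suitable weak solution in `Q(0, 1)` of Albritton–Barker's class with
   `𝐈(Q(0, 1/2)) < ∞`, A–B Lemma 2.6); the zoom is backward-singular at the origin
   (`SereginSverak2002.isBackwardBoundedAt_of_zoom`) and carries the rate on a final window;
2. after a further zoom by `1/2` (so that Seregin's cylinder `𝒞 × (−1, 0)` lies in `Q(0, 2)`),
   the zoom-in at the origin `Seregin2020.exists_ancientLimit` (Seregin 2014, Prop. 6.20 /
   Seregin 2020: compactness, diagonal, gluing, persistence of the singularity);
3. `slab_typeIBound_of_zoomLimit` (`𝐈 ≤ 4 𝐈(Q(0, 1))` on the slab by lower semicontinuity),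
   `ae_rate_of_zoomLimit` (the rate a.e.) and `exists_rate_profile_repr` (a representative with
   the pointwise rate).

## References

* D. Albritton, T. Barker, J. Math. Fluid Mech. 21 (2019) = arXiv:1811.00502, §2–§3, Remark 3.2.
  [AlbrittonBarker2019]
* G. Seregin, *Lecture Notes on Regularity Theory for the Navier–Stokes Equations* (2014), §6.6,
  Prop. 6.20. [Seregin2014]
* P. G. Lemarié-Rieusset, *The Navier–Stokes Problem in the 21st Century* (2016), Thm. 15.1.
  [LemarieRieusset2016]
* G. Koch, N. Nadirashvili, G. Seregin, V. Šverák, Acta Math. 203 (2009), §6. [KNSS2009]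
-/

noncomputable section

set_option linter.dupNamespace false

namespace Summit.NavierStokesRegularity.NavierStokesRegularity.Theorems

open MeasureTheory Set Function Filter Topology TopologicalSpace Metric
open Literature.Analysis.FluidPDE Literature.Analysis.FluidPDE.SereginSverak2009
open scoped NNReal ENNReal

/-- **`TypeIBlowupProfile` (item stmt-NavierStokesRegularity-1591).** A maximal classical solution
of Navier–Stokes (viscosity `ν > 0`) on `ℝ³ × [0, T)`, Leray–Hopf from its rapidly decaying datum,
blowing up at the Type-I rate `‖u(t, x)‖ ≤ C/√(T − t)`, generates a profile in the Albritton–Barker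
class: a suitable weak solution `(w, q)` of the unit-viscosity system on the backward slab
`ℝ³ × ℝ₋` with weak gradient `H`, `𝐈(ℝ³ × ℝ₋) < ∞`, the pointwise rate `‖w(t, x)‖ ≤ C'/√(−t)` and
a backward-singular origin. Proof: (1) the Morrey bound of a Type-I solution (`morrey_of_typeI`),
a singular point `(T, x₀)` at the maximal time (Lemarié-Rieusset 2016, Thm. 15.1 (C):
`exists_singularPoint_of_classical_of_not_hasSmoothExtensionPast`) and the viscosity-normalising
zoom about `(T, x₀)`, a suitable weak solution in `Q(0, 1)` with `𝐈(Q(0, 1/2)) < ∞`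
(`exists_zoom_typeIBound_lt_top_of_morrey`, Albritton–Barker Lemma 2.6), backward-singular at the
origin and carrying the rate; (2) the zoom-in at the origin (Seregin 2020 / Seregin 2014,
Prop. 6.20: `Seregin2020.exists_ancientLimit` — compactness of suitable weak solutions, Cantor
diagonal, gluing, persistence of the singularity by CKN ε-regularity); (3) `𝐈 ≤ 4 𝐈(Q(0,1/2))`
on the slab by lower semicontinuity (`slab_typeIBound_of_zoomLimit`), the rate a.e. by
`ae_rate_of_zoomLimit`, and a representative with the pointwise rate
(`exists_rate_profile_repr`). [cite: AlbrittonBarker2019, §3 and Remark 3.2; Seregin2014, §6.6 Prop. 6.20; LemarieRieusset2016, Thm. 15.1] -/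
theorem typeIBlowupProfile_proof :
    Summit.NavierStokesRegularity.NavierStokesRegularity.Theses.RellichScar.TypeIBlowupProfile := by
  unfold Summit.NavierStokesRegularity.NavierStokesRegularity.Theses.RellichScar.TypeIBlowupProfile
  intro ν T hν hT u p hmax hLH hdec hI
  have hsol := hmax.1
  have hext := hmax.2
  -- ## (1) Morrey bound, a singular point at the maximal time, the viscosity-normalising zoom
  obtain ⟨r₀, M₀, T₁, hr₀, hT₁, hMor⟩ := morrey_of_typeI hν hT hsol hLH hI
  obtain ⟨x₀, hx₀⟩ :=
    exists_singularPoint_of_classical_of_not_hasSmoothExtensionPast hν hT hsol hLH hdec hext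
  obtain ⟨R, α, β, hR, hα, hβ, -, -, hβT, hball, hGv, htypeI⟩ :=
    exists_zoom_typeIBound_lt_top_of_morrey hν hT hsol hLH hr₀ hT₁ hMor x₀
  set q : ℝ → EuclideanSpace ℝ (Fin 3) → ℝ :=
    fun t x => p t x - (p t 0 - normalisedPressure (u t) 0) with hq
  set v : ℝ → EuclideanSpace ℝ (Fin 3) → EuclideanSpace ℝ (Fin 3) := α • stPull β R T x₀ u with hv
  set πv : ℝ → EuclideanSpace ℝ (Fin 3) → ℝ := α ^ 2 • stPull β R T x₀ q with hπv
  set Gv : ℝ → EuclideanSpace ℝ (Fin 3) → EuclideanSpace ℝ (Fin 3) →L[ℝ] EuclideanSpace ℝ (Fin 3) :=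
    (α * R) • stPull β R T x₀ (fun t x => fderiv ℝ (u t) x) with hGvdef
  -- ## (2) the origin is a backward singular point of the zoom
  have hnotbd : ¬ IsBackwardBoundedAt u T x₀ := by
    rintro ⟨r, hr, K, hK⟩
    set r' : ℝ := min r (Real.sqrt (T / 2)) with hr'def
    have hr' : 0 < r' := lt_min hr (Real.sqrt_pos.2 (by positivity))
    have hr'T : r' ^ 2 < T := by
      have h1 : r' ≤ Real.sqrt (T / 2) := min_le_right _ _
      have h2 : r' ^ 2 ≤ T / 2 := by
        have := pow_le_pow_left₀ hr'.le h1 2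
        rwa [Real.sq_sqrt (by positivity)] at this
      linarith
    have hfin : eLpNorm (uncurry u) ∞
        (volume.restrict (parabolicCylinder r' ((T : ℝ), x₀))) < ∞ := by
      rw [eLpNorm_exponent_top]
      refine eLpNormEssSup_lt_top_of_ae_bound (C := K) ?_
      refine (ae_restrict_mem (isOpen_parabolicCylinder r' _).measurableSet).mono ?_
      rintro ⟨t, x⟩ hz
      rw [mem_parabolicCylinder] at hz
      have hrr : r' ^ 2 ≤ r ^ 2 := pow_le_pow_left₀ hr'.le (min_le_left _ _) 2
      refine hK t ⟨by linarith [hz.1.1], hz.1.2⟩ x ?_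
      exact mem_ball.2 (lt_of_lt_of_le hz.2 (min_le_left _ _))
    exact hfin.ne (hx₀ r' hr' hr'T)
  have hsing : IsBackwardSingularPoint v (0 : ℝ × EuclideanSpace ℝ (Fin 3)) := by
    intro r hr
    by_contra hfin
    have hfin' : eLpNorm (uncurry v) ⊤
        (volume.restrict (parabolicCylinder (min r 1) (0 : ℝ × EuclideanSpace ℝ (Fin 3)))) < ⊤ := by
      refine lt_of_le_of_lt (eLpNorm_mono_measure _ (Measure.restrict_mono ?_ le_rfl))
        (lt_top_iff_ne_top.2 hfin)
      exact SuitableCompactness.parabolicCylinder_zero_mono (le_min hr.le zero_le_one) (min_le_left _ _)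
    exact hnotbd (SereginSverak2002.isBackwardBoundedAt_of_zoom hsol x₀ hR hα hβ hβT
      (lt_min hr one_pos) (min_le_right _ _) hfin')
  -- ## (3) the rate of the zoom on a final window
  obtain ⟨C, δ, hC0, hδ, -, hrate⟩ := exists_typeI_rate_window hT hI
  set C₁ : ℝ := α * C / Real.sqrt β with hC₁def
  have hC₁ : 0 ≤ C₁ := by positivity
  have hratev : ∀ s ∈ Ioo (-(δ / β)) 0, ∀ y, ‖v s y‖ ≤ C₁ / Real.sqrt (-s) := by
    intro s hs y
    have h1 : -δ < β * s := by
      have h := mul_lt_mul_of_pos_left hs.1 hβ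
      rwa [mul_neg, mul_div_cancel₀ _ hβ.ne'] at h
    have h2 : β * s < 0 := mul_neg_of_pos_of_neg hβ hs.2
    have hb := hrate (T + β * s) ⟨by linarith, by linarith⟩ (x₀ + R • y)
    have hsq : Real.sqrt (T - (T + β * s)) = Real.sqrt β * Real.sqrt (-s) := by
      rw [show T - (T + β * s) = β * (-s) by ring, Real.sqrt_mul hβ.le]
    rw [hsq] at hb
    have hpos : 0 < Real.sqrt (-s) := Real.sqrt_pos.2 (by linarith [hs.2])
    have hposβ : 0 < Real.sqrt β := Real.sqrt_pos.2 hβ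
    rw [hv, smul_stPull_apply, norm_smul, Real.norm_of_nonneg hα.le, hC₁def]
    rw [div_div, le_div_iff₀ (by positivity)]
    calc α * ‖u (T + β * s) (x₀ + R • y)‖ * (Real.sqrt β * Real.sqrt (-s))
        = α * (Real.sqrt β * Real.sqrt (-s) * ‖u (T + β * s) (x₀ + R • y)‖) := by ring
      _ ≤ α * C := mul_le_mul_of_nonneg_left hb hα.le
  -- ## (4) the second zoom by `1/2`: the class on `Q(0, 2) ⊇ 𝒞 × (−1, 0)`
  have hc : (0 : ℝ) < 1 / 2 := by norm_num
  set v' : ℝ → EuclideanSpace ℝ (Fin 3) → EuclideanSpace ℝ (Fin 3) :=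
    (1 / 2 : ℝ) • stPull ((1 / 2 : ℝ) ^ 2) (1 / 2) (0 : ℝ) (0 : EuclideanSpace ℝ (Fin 3)) v with hv'
  set π' : ℝ → EuclideanSpace ℝ (Fin 3) → ℝ :=
    (1 / 2 : ℝ) ^ 2 • stPull ((1 / 2 : ℝ) ^ 2) (1 / 2) (0 : ℝ) (0 : EuclideanSpace ℝ (Fin 3)) πv
    with hπ'
  set G' : ℝ → EuclideanSpace ℝ (Fin 3) → EuclideanSpace ℝ (Fin 3) →L[ℝ] EuclideanSpace ℝ (Fin 3) :=
    (1 / 2 : ℝ) ^ 2 • stPull ((1 / 2 : ℝ) ^ 2) (1 / 2) (0 : ℝ) (0 : EuclideanSpace ℝ (Fin 3)) Gv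
    with hG'def
  have hball' : IsSuitableWeakSolutionInBall 2 0 v' π' := by
    have h := hball.zoomOut hc
    rwa [show (1 : ℝ) / (1 / 2) = 2 by norm_num] at h
  have hG' : HasWeakSpatialGradientOn
      (parabolicCylinderOpens 2 (0 : ℝ × EuclideanSpace ℝ (Fin 3))) v' G' := by
    have h := hGv.stRescale (1 / 2 : ℝ) (pow_pos hc 2) hc (0 : ℝ) (0 : EuclideanSpace ℝ (Fin 3))
    have hpre : stPreimage ((1 / 2 : ℝ) ^ 2) (1 / 2) (0 : ℝ) (0 : EuclideanSpace ℝ (Fin 3))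
        (parabolicCylinderOpens 1 (0 : ℝ × EuclideanSpace ℝ (Fin 3))) =
        parabolicCylinderOpens 2 (0 : ℝ × EuclideanSpace ℝ (Fin 3)) := by
      apply Opens.ext
      rw [coe_stPreimage, coe_parabolicCylinderOpens, coe_parabolicCylinderOpens,
        stAffine_preimage_parabolicCylinder_zero hc, show (1 : ℝ) / (1 / 2) = 2 by norm_num]
    rw [hpre, ← sq] at h
    exact h
  have hI' : typeIBound (parabolicCylinder 1 (0 : ℝ × EuclideanSpace ℝ (Fin 3))) v' π' G' < ⊤ := by
    have h := typeIBound_nsZoom hc (0 : ℝ) (0 : EuclideanSpace ℝ (Fin 3))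
      (parabolicCylinder (1 / 2) (0 : ℝ × EuclideanSpace ℝ (Fin 3))) v πv Gv
    rw [stAffine_preimage_parabolicCylinder_zero hc, show (1 / 2 : ℝ) / (1 / 2) = 1 by norm_num] at h
    rw [hv', hπ', hG'def, h]
    exact htypeI
  have hsing' : IsBackwardSingularPoint v' (0 : ℝ × EuclideanSpace ℝ (Fin 3)) := by
    intro r hr
    rw [hv', eLpNorm_top_nsZoom hc, Seregin2020.stAffine_zero_zero_apply_zero,
      hsing ((1 / 2) * r) (by positivity)]
    exact ENNReal.mul_top (by simp)
  have hratev' : ∀ s ∈ Ioo (-((δ / β) / (1 / 2 : ℝ) ^ 2)) 0, ∀ y, ‖v' s y‖ ≤ C₁ / Real.sqrt (-s) :=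
    fun s hs y => norm_nsZoom_le_rate hc hratev hs y
  -- ## (5) the inputs of the zoom-in extraction on `𝒞 × (−1, 0) ⊆ Q(0, 2)`
  have hsqrt2 : Real.sqrt 2 ≤ 2 := by
    rw [Real.sqrt_le_left (by norm_num)]
    norm_num
  have hPQ : parCyl (0 : ℝ × EuclideanSpace ℝ (Fin 3)) 1 ⊆
      parabolicCylinder 2 (0 : ℝ × EuclideanSpace ℝ (Fin 3)) := by
    intro z hz
    obtain ⟨ht, hx⟩ := hz
    have hx' := spaceCyl_subset_ball (0 : EuclideanSpace ℝ (Fin 3)) zero_le_one hx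
    rw [mul_one, mem_ball_zero_iff] at hx'
    simp only [Prod.fst_zero, one_pow, zero_sub, mem_Ioo] at ht
    rw [SuitableCompactness.mem_parabolicCylinder_zero]
    exact ⟨⟨by linarith [ht.1], ht.2⟩, lt_of_lt_of_le hx' hsqrt2⟩
  have hle : parCylOpens (0 : ℝ × EuclideanSpace ℝ (Fin 3)) 1 ≤
      parabolicCylinderOpens 2 (0 : ℝ × EuclideanSpace ℝ (Fin 3)) := fun z hz => hPQ hz
  have hsw3 : IsSuitableWeakSolutionOn (parCylOpens (0 : ℝ × EuclideanSpace ℝ (Fin 3)) 1) 1 0 v' π' :=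
    IsSuitableWeakSolutionOn.mono_holds hball'.1 hle
  have hA3 : ∃ Cc : ℝ≥0, ∀ᵐ t ∂(volume.restrict (Ioo (-1 : ℝ) 0)),
      ∫⁻ x in spaceCyl (0 : EuclideanSpace ℝ (Fin 3)) 1, ‖v' t x‖ₑ ^ 2 ≤ Cc := by
    obtain ⟨Cc, hCc⟩ := hball'.2.1
    refine ⟨Cc, ?_⟩
    have hsub : Ioo (-1 : ℝ) 0 ⊆ Ioo ((0 : ℝ × EuclideanSpace ℝ (Fin 3)).1 - 2 ^ 2)
        (0 : ℝ × EuclideanSpace ℝ (Fin 3)).1 := by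
      intro t ht
      simp only [Prod.fst_zero, zero_sub, mem_Ioo]
      exact ⟨by linarith [ht.1], ht.2⟩
    have hballsub : spaceCyl (0 : EuclideanSpace ℝ (Fin 3)) 1 ⊆
        ball (0 : ℝ × EuclideanSpace ℝ (Fin 3)).2 2 := by
      refine (spaceCyl_subset_ball (0 : EuclideanSpace ℝ (Fin 3)) zero_le_one).trans ?_
      rw [mul_one, Prod.snd_zero]
      exact ball_subset_ball hsqrt2
    filter_upwards [ae_restrict_of_ae_restrict_of_subset hsub hCc] with t ht
    exact (lintegral_mono_set hballsub).trans ht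
  have hG3 : HasWeakSpatialGradientOn (parCylOpens (0 : ℝ × EuclideanSpace ℝ (Fin 3)) 1) v' G' :=
    hG'.mono hle
  have hE3 : ∫⁻ z in parCyl (0 : ℝ × EuclideanSpace ℝ (Fin 3)) 1,
      ENNReal.ofReal (frobeniusNormSq (G' z.1 z.2)) < ∞ := by
    obtain ⟨G'', hG'', hG''2⟩ := hball'.2.2.1
    have hae := hG'.ae_eq hG''
    rw [coe_parabolicCylinderOpens] at hae
    refine lt_of_le_of_lt (lintegral_mono_set hPQ) ?_
    have e : ∫⁻ z in parabolicCylinder 2 (0 : ℝ × EuclideanSpace ℝ (Fin 3)),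
        ENNReal.ofReal (frobeniusNormSq (G' z.1 z.2)) =
        ∫⁻ z in parabolicCylinder 2 (0 : ℝ × EuclideanSpace ℝ (Fin 3)),
        ENNReal.ofReal (frobeniusNormSq (G'' z.1 z.2)) := by
      refine lintegral_congr_ae ?_
      filter_upwards [hae] with z hz
      have hz' : G' z.1 z.2 = G'' z.1 z.2 := hz
      rw [hz']
    rw [e]
    exact hG''2
  have hp3 : ∫⁻ z in parCyl (0 : ℝ × EuclideanSpace ℝ (Fin 3)) 1,
      ‖π' z.1 z.2‖ₑ ^ (3 / 2 : ℝ) < ∞ := by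
    obtain ⟨h32, h32', h32r⟩ := threeHalves_facts
    have hm : MemLp (uncurry π') (3 / 2)
        (volume.restrict (parabolicCylinder 2 (0 : ℝ × EuclideanSpace ℝ (Fin 3)))) := hball'.2.2.2
    have h2 := hm.2
    rw [eLpNorm_eq_lintegral_rpow_enorm_toReal (by norm_num) h32', h32r] at h2
    have hfin : ∫⁻ z in parabolicCylinder 2 (0 : ℝ × EuclideanSpace ℝ (Fin 3)),
        ‖uncurry π' z‖ₑ ^ (3 / 2 : ℝ) < ∞ := by
      by_contra htop
      rw [not_lt, top_le_iff] at htop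
      rw [htop, ENNReal.top_rpow_of_pos (by norm_num)] at h2
      exact lt_irrefl _ h2
    exact lt_of_le_of_lt (lintegral_mono_set hPQ) hfin
  have hI3 : Seregin2020.blowupIndex 0 v' G' < ∞ := by
    refine lt_of_le_of_lt (Seregin2020.blowupIndex_le_limsup_cknC 0 v' G') (lt_of_le_of_lt ?_ hI')
    refine limsup_le_of_le (by isBoundedDefault) ?_
    filter_upwards [Ioo_mem_nhdsGT (zero_lt_one' ℝ)] with r hr
    exact cknC_le_abScaledSum.trans (abScaledSum_le_typeIBound hr.1
      (SuitableCompactness.parabolicCylinder_zero_mono hr.1.le hr.2.le))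
  -- ## (6) the zoom-in limit at the singular origin
  obtain ⟨K, κ, lam, w, ϖ, -, hlam, hlam0, hsingw, hlimw⟩ :=
    Seregin2020.exists_ancientLimit hsw3 hA3 hG3 hE3 hp3 hsing' hI3
  -- ## (7) the slab class with `𝐈 ≤ 4 𝐈(Q(0,1))`
  have hball1 : IsSuitableWeakSolutionInBall 1 0 v' π' :=
    SuitableCompactness.isSuitableWeakSolutionInBall_of_le_radius hball' (by norm_num) (by norm_num)
  have hG1 : HasWeakSpatialGradientOn
      (parabolicCylinderOpens 1 (0 : ℝ × EuclideanSpace ℝ (Fin 3))) v' G' :=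
    hG'.mono (SuitableCompactness.parabolicCylinderOpens_zero_mono (by norm_num) (by norm_num))
  obtain ⟨hsww, H, hH, h4I⟩ := slab_typeIBound_of_zoomLimit
    (typeIBound (parabolicCylinder 1 (0 : ℝ × EuclideanSpace ℝ (Fin 3))) v' π' G') hI' one_pos
    hball1 hG1 le_rfl hlam hlam0
    (fun a ha => ⟨(hlimw a ha).1, (hlimw a ha).2.1, (hlimw a ha).2.2.1, (hlimw a ha).2.2.2.1⟩)
  -- ## (8) the rate, almost everywhere on the slab
  have hvm : ∀ a : ℝ, 0 < a → ∀ᶠ j in atTop, AEStronglyMeasurable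
      (uncurry ((lam j) • stPull ((lam j) ^ 2) (lam j) (0 : ℝ) (0 : EuclideanSpace ℝ (Fin 3)) v'))
      (volume.restrict (parabolicCylinder a (0 : ℝ × EuclideanSpace ℝ (Fin 3)))) := by
    intro a ha
    have hev : ∀ᶠ j in atTop, lam j < 1 / a := hlam0 (Iio_mem_nhds (by positivity))
    filter_upwards [hev] with j hj
    have hμ := hlam j
    have h := hG1.stRescale (lam j) (pow_pos hμ 2) hμ (0 : ℝ) (0 : EuclideanSpace ℝ (Fin 3))
    have hsub : parabolicCylinder a (0 : ℝ × EuclideanSpace ℝ (Fin 3)) ⊆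
        ((stPreimage ((lam j) ^ 2) (lam j) (0 : ℝ) (0 : EuclideanSpace ℝ (Fin 3))
          (parabolicCylinderOpens 1 (0 : ℝ × EuclideanSpace ℝ (Fin 3))) :
            Opens (ℝ × EuclideanSpace ℝ (Fin 3))) : Set (ℝ × EuclideanSpace ℝ (Fin 3))) := by
      rw [coe_stPreimage, coe_parabolicCylinderOpens, stAffine_preimage_parabolicCylinder_zero hμ]
      refine SuitableCompactness.parabolicCylinder_zero_mono ha.le ?_
      rw [le_div_iff₀ hμ, mul_comm]
      exact ((lt_div_iff₀ ha).1 hj).le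
    exact h.locallyIntegrableOn.aestronglyMeasurable.mono_measure (Measure.restrict_mono hsub le_rfl)
  have hae_rate := ae_rate_of_zoomLimit (by positivity : (0 : ℝ) < (δ / β) / (1 / 2 : ℝ) ^ 2)
    hratev' hlam hlam0 hvm (fun a ha => ⟨(hlimw a ha).2.1.1, (hlimw a ha).2.2.1⟩)
  -- ## (9) a representative with the pointwise rate
  have h4top : typeIBound (Iio (0 : ℝ) ×ˢ univ) w ϖ H < ∞ :=
    lt_of_le_of_lt h4I (ENNReal.mul_lt_top (by simp) hI')
  obtain ⟨w', -, hsw', hwg', hIw', hdec', hsing''⟩ :=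
    exists_rate_profile_repr hC₁ hsww hH h4top hsingw hae_rate
  exact ⟨w', ϖ, H, C₁, hsw', hwg', hIw', hdec', hsing''⟩

/-- The same item as filed on route RecurrentProfiles (identical statement, shared item
stmt-NavierStokesRegularity-1591). [cite: AlbrittonBarker2019, §3] -/
theorem typeIBlowupProfile_recurrentProfiles :
    Summit.NavierStokesRegularity.NavierStokesRegularity.Theses.RecurrentProfiles.TypeIBlowupProfile :=
  typeIBlowupProfile_proof

/-- The same item as filed on route DulacContraction (identical statement, shared item
stmt-NavierStokesRegularity-1591). [cite: AlbrittonBarker2019, §3] -/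
theorem typeIBlowupProfile_dulacContraction :
    Summit.NavierStokesRegularity.NavierStokesRegularity.Theses.DulacContraction.TypeIBlowupProfile :=
  typeIBlowupProfile_proof

end Summit.NavierStokesRegularity.NavierStokesRegularity.Theorems
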